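import Summits.CriticalPhenomena.PercolationContinuityZ3.Theorems.PercFiniteBoxLRORenormaliseFromLinearLROLinearTwoArms

/-!
# Crux `PercFiniteBoxLRO.RenormaliseFromLinearLRO` (stmt-CriticalPhenomena-0857), line `registered`, lead cycle 3 —
# the TWO-ARMS FRONTIER of the line: a percolating `p_c` forces linear-scale box two-arms `≥ c·θ(p_c)²/K` at EVERY
# ratio `K`, so a linear two-arms rate `o(1/K)` already gives `θ(p_c) = 0` (the conjunct), hence the crux

The registered sub-goal `stub_lroForcesLinearTwoArms` (p163651) used its hypothesis `LRO_lin(p_c)` only through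
`θ(p_c) ≥ ρ > 0`.  Reading the same proof with the hypothesis `0 < θ(p_c)` and keeping the ratio `K ≥ 2` free gives the
sharper, LRO-free anatomy of this file:

* `twoArms_criticalProbI_ge` — there is an ABSOLUTE `c > 0` (`= δ₀/2000`, `δ₀` the spine threshold of
  `stub_noSpineAtPc`) such that for every `K ≥ 2`, all large local scales `s` and, given `s`, all large grid sizes `m`,
  the box two-arms event of item r5 (`CritBoxTwoArmsDecay` vocabulary) at radii `n = (2s+1)m`, `M = K·n` has
  `P_{p_c}`-probability `≥ c·θ(p_c)²/K`.  (Trivial when `θ(p_c) = 0`; the content is the hypothetical percolating `p_c`.)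
* `theta_criticalProbI_eq_zero_of_linearTwoArms_littleO` — CONTRAPOSITIVE: if, in a percolating world, the linear-scale
  two-arms probability is `o(1/K)` — `0 < θ(p_c) → ∀ ε > 0, ∃ K ≥ 2, ∃ N, ∀ n ≥ N, P_{p_c}(two-arms(n, K n)) ≤ ε/K` —
  then `θ(p_c) = 0`; `percolationContinuityZ3_of_linearTwoArms_littleO` is the same conclusion under its Literature name
  (the sub-problem's conjunct), `renormaliseFromLinearLRO_of_linearTwoArms_littleO` the crux BY NAME, and
  `critSpine_of_linearTwoArms_littleO` the line's open stub `stub_critSpine` (vacuously: no `LRO_lin(p_c)` is left).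
* `linearTwoArms_littleO_of_exponent` — the rate hypothesis follows from a linear-scale box two-arms EXPONENT `> 1`
  (`P_{p_c}(two-arms(n, K n)) ≤ C·K^{-γ}` for all large `n`, some `γ > 1`); the believed value in `d = 3` is
  `γ = d − D_backbone ≈ 3 − 1.86 > 1`, while in print only the POINT two-arms exponent is bounded (`≥ 12/23`, Cerf2015
  Thm 1.1; `≤ d² + 4d − 2`, VandenbergVanengelenburg2022 Thm 1), and VandenbergVanengelenburg2022 Prop. 2 gives the
  unconditional lower bound `P_{p_c}(A₂(nᵢ, M nᵢ)) ≥ δ(M)` along a scale sequence with an LSS-sized `δ(M) ≪ 1/M` —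
  compatible with the rate hypothesis.  KozmaNitzan2024 §1 lists "two-arms exponent too large ⇒ θ(p_c) = 0" as folklore
  approach (5) (van Engelenburg, MSc thesis 2020, §4.3); the `1/K` form with the factor `θ(p_c)²` is what the
  second-moment boost of this line produces.

So the frontier of line `registered` is a RATE: its same-`p` boost (dense/spine blocks + Markov) closes the crux exactly
when linear two-arms is `o(1/K)` in the hypothetical LRO world, and that much input proves the whole conjunct.
Lands `--supports stmt-CriticalPhenomena-0857`.
-/

noncomputable section

namespace Summit.CriticalPhenomena.PercolationContinuityZ3.Theorems.RenormaliseFromLinearLRO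

open Literature.Probability.Percolation Literature.Probability.LatticeModels
open MeasureTheory Filter Topology

/-! ## A percolating `p_c` forces linear two-arms `≥ c·θ(p_c)²/K` at every ratio -/

/-- **Linear-scale box two-arms at a percolating `p_c`, every ratio.**  There is an absolute `c > 0` such that for every
`K ≥ 2` there is `s₀` with: for all `s ≥ s₀` there is `m₀` with: for all `m ≥ m₀`, writing `n = (2s+1)m`,
`c·θ(p_c)²/K ≤ P_{p_c}(∃ x, x' ∈ Λ(n), ∃ z, z' ∈ ∂ⁱⁿΛ(Kn): x ↔ z and x' ↔ z' inside Λ(Kn), x ↮ x' inside Λ(Kn))`.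
Proof: `c := δ₀/2000` (`δ₀` of `stub_noSpineAtPc`); if `θ(p_c) = 0` there is nothing to prove; otherwise, with
`η₀ := c/K`, `pairSum_lt_criticalProbI` (no spine is likely at `p_c`, so the second-moment hypothesis of `stub_denseMarkov`
fails: `Σ P(y ↔ y' in Λ(Kn)) < (1 − 2η₀)θ_s² g²`) and `twoArms_real_mul_ge` (`g(g−1)·P(two-arms) ≥ g(g−1)(θ_s² − 2(θ_s − θ))
− Σ P(y ↔ y' in Λ(Kn))`) give `P(two-arms) ≥ 2η₀θ_s² − θ_s²/(g−1) − 2(θ_s − θ) ≥ η₀θ²` once `θ_s − θ ≤ η₀θ²/4`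
(`s` large, `θ_s ↓ θ`) and `4/g ≤ η₀θ²/4` (`m` large). -/
theorem twoArms_criticalProbI_ge :
    ∃ c : ℝ, 0 < c ∧ ∀ K : ℕ, 2 ≤ K → ∃ s₀ : ℕ, ∀ s : ℕ, s₀ ≤ s → ∃ m₀ : ℕ, ∀ m : ℕ, m₀ ≤ m →
      c * theta (zdGraph 3) 0 (criticalProbI 3) ^ 2 / K ≤
        (bondPercolation (zdGraph 3) (criticalProbI 3)).real
          {ω | ∃ x ∈ box 3 ((2 * s + 1) * m), ∃ x' ∈ box 3 ((2 * s + 1) * m),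
            ∃ z ∈ innerBoundary (zdGraph 3) (box 3 (K * ((2 * s + 1) * m))),
              ∃ z' ∈ innerBoundary (zdGraph 3) (box 3 (K * ((2 * s + 1) * m))),
                ω ∈ openConnIn ↑(box 3 (K * ((2 * s + 1) * m))) x z ∧
                  ω ∈ openConnIn ↑(box 3 (K * ((2 * s + 1) * m))) x' z' ∧
                    ω ∉ openConnIn ↑(box 3 (K * ((2 * s + 1) * m))) x x'} := by
  obtain ⟨δ₀, hδ, hle⟩ := stub_noSpineAtPc
  refine ⟨δ₀ / 2000, by positivity, ?_⟩
  intro K hK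
  set P := bondPercolation (zdGraph 3) (criticalProbI 3) with hP
  set θ : ℝ := theta (zdGraph 3) 0 (criticalProbI 3) with hθdef
  have hK0 : (0 : ℝ) < K := by exact_mod_cast (lt_of_lt_of_le (by norm_num) hK : 0 < K)
  set η₀ : ℝ := δ₀ / 2000 / K with hη₀
  have hη₀pos : 0 < η₀ := by positivity
  have hgoal : δ₀ / 2000 * θ ^ 2 / K = η₀ * θ ^ 2 := by rw [hη₀]; ring
  -- the non-percolating case is trivial
  by_cases hθ : 0 < θ
  swap
  · have hθ0 : θ = 0 := le_antisymm (not_lt.1 hθ) measureReal_nonneg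
    refine ⟨0, fun s _ => ⟨0, fun m _ => ?_⟩⟩
    rw [hgoal, hθ0]
    simp [measureReal_nonneg]
  -- s₀: θ_s - θ ≤ η₀ θ² / 4 beyond s₀
  have hlim := tendsto_real_siteToBoundary (d := 3) (criticalProbI 3)
  have hε : 0 < η₀ * θ ^ 2 / 4 := by positivity
  obtain ⟨s₀, hs₀⟩ := (Metric.tendsto_atTop.1 hlim) (η₀ * θ ^ 2 / 4) hε
  refine ⟨s₀, fun s hs => ?_⟩
  set θs : ℝ := P.real (siteToBoundary 3 s) with hθs
  have hθs_ge : θ ≤ θs := DCT16.theta_le_real_siteToBoundary (criticalProbI 3) s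
  have hθs_pos : 0 < θs := hθ.trans_le hθs_ge
  have hθs1 : θs ≤ 1 := measureReal_le_one
  have hclose : θs - θ ≤ η₀ * θ ^ 2 / 4 := by
    have h := hs₀ s hs
    rw [Real.dist_eq, abs_lt] at h
    linarith [h.2]
  -- m₀: the Markov remainder and 4/g are small
  have ht1 : Tendsto (fun m : ℕ => (4 * (K : ℝ) + 2) * (200 / (θs ^ 2 * (m : ℝ) ^ 3))) atTop (𝓝 0) := by
    have h3 : Tendsto (fun m : ℕ => θs ^ 2 * (m : ℝ) ^ 3) atTop atTop :=
      Tendsto.const_mul_atTop (by positivity)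
        ((tendsto_pow_atTop (by norm_num : (3 : ℕ) ≠ 0)).comp (tendsto_natCast_atTop_atTop (R := ℝ)))
    have h4 : Tendsto (fun m : ℕ => (200 : ℝ) / (θs ^ 2 * (m : ℝ) ^ 3)) atTop (𝓝 0) :=
      tendsto_const_nhds.div_atTop h3
    simpa using h4.const_mul (4 * (K : ℝ) + 2)
  have ht2 : Tendsto (fun m : ℕ => (4 : ℝ) / ((coreGrid s m).card : ℝ)) atTop (𝓝 0) := by
    have hg : Tendsto (fun m : ℕ => ((coreGrid s m).card : ℝ)) atTop atTop := by
      have : (fun m : ℕ => ((coreGrid s m).card : ℝ)) = fun m : ℕ => (2 * (m : ℝ) + 1) ^ 3 := by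
        funext m; rw [card_coreGrid]; push_cast; ring
      rw [this]
      refine (tendsto_pow_atTop (by norm_num : (3 : ℕ) ≠ 0)).comp ?_
      exact tendsto_atTop_add_const_right _ 1 (Tendsto.const_mul_atTop (by norm_num)
        (tendsto_natCast_atTop_atTop (R := ℝ)))
    exact tendsto_const_nhds.div_atTop hg
  obtain ⟨m₀, hm₀⟩ := (((ht1.eventually (gt_mem_nhds (half_pos hδ))).and
    (ht2.eventually (gt_mem_nhds hε))).and (eventually_ge_atTop 1)).exists_forall_of_atTop
  refine ⟨m₀, fun m hm => ?_⟩
  obtain ⟨⟨hm1, hm2⟩, hm3⟩ := hm₀ m hm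
  set g : ℝ := ((coreGrid s m).card : ℝ) with hg
  have hg27 : (27 : ℝ) ≤ g := by
    rw [hg, card_coreGrid]; push_cast
    have : (1 : ℝ) ≤ m := by exact_mod_cast hm3
    nlinarith [pow_le_pow_left₀ (by norm_num : (0:ℝ) ≤ 3) (by linarith : (3 : ℝ) ≤ 2 * m + 1) 3]
  have hgpos : 0 < g := by linarith
  have hg1 : 0 < g - 1 := by linarith
  -- the pair sum is small (spine contrapositive) and the two-arms bound
  have hsmall := pairSum_lt_criticalProbI hδ hle hK hm3 hθs_pos hm1
  have hbig := twoArms_real_mul_ge (criticalProbI 3) K s m (by omega)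
  set T := P.real {ω | ∃ x ∈ box 3 ((2 * s + 1) * m), ∃ x' ∈ box 3 ((2 * s + 1) * m),
      ∃ z ∈ innerBoundary (zdGraph 3) (box 3 (K * ((2 * s + 1) * m))),
        ∃ z' ∈ innerBoundary (zdGraph 3) (box 3 (K * ((2 * s + 1) * m))),
          ω ∈ openConnIn ↑(box 3 (K * ((2 * s + 1) * m))) x z ∧
            ω ∈ openConnIn ↑(box 3 (K * ((2 * s + 1) * m))) x' z' ∧
              ω ∉ openConnIn ↑(box 3 (K * ((2 * s + 1) * m))) x x'} with hT
  -- g(g-1) T ≥ g(g-1)(θs² - 2(θs-θ)) - (1-2η₀) θs² g²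
  have hkey : g * (g - 1) * (θs ^ 2 - 2 * (θs - θ)) - (1 - 2 * η₀) * θs ^ 2 * g ^ 2 ≤ g * (g - 1) * T := by
    linarith [hbig, hsmall]
  -- divide: T ≥ 2η₀θs² - θs²/(g-1) - 2(θs - θ)
  have hT0 : 2 * η₀ * θs ^ 2 - θs ^ 2 / (g - 1) - 2 * (θs - θ) ≤ T := by
    have e : g * (g - 1) * (θs ^ 2 - 2 * (θs - θ)) - (1 - 2 * η₀) * θs ^ 2 * g ^ 2 =
        g * (g - 1) * (2 * η₀ * θs ^ 2 - 2 * (θs - θ)) - (1 - 2 * η₀) * θs ^ 2 * g := by ring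
    rw [e] at hkey
    have h1 : g * (g - 1) * (2 * η₀ * θs ^ 2 - 2 * (θs - θ)) - θs ^ 2 * g ≤ g * (g - 1) * T := by
      have : 0 ≤ 2 * η₀ * θs ^ 2 * g := by positivity
      nlinarith [hkey]
    have h2 : g * (g - 1) * (2 * η₀ * θs ^ 2 - θs ^ 2 / (g - 1) - 2 * (θs - θ)) =
        g * (g - 1) * (2 * η₀ * θs ^ 2 - 2 * (θs - θ)) - θs ^ 2 * g := by
      field_simp
      ring
    have h3 : g * (g - 1) * (2 * η₀ * θs ^ 2 - θs ^ 2 / (g - 1) - 2 * (θs - θ)) ≤ g * (g - 1) * T := by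
      rw [h2]; exact h1
    exact le_of_mul_le_mul_left h3 (mul_pos hgpos hg1)
  have hdiv : θs ^ 2 / (g - 1) ≤ η₀ * θ ^ 2 / 4 := by
    have h1 : θs ^ 2 / (g - 1) ≤ 1 / (g - 1) := by
      apply div_le_div_of_nonneg_right _ hg1.le
      nlinarith
    have h2 : (1 : ℝ) / (g - 1) ≤ 4 / g := by
      rw [div_le_div_iff₀ hg1 hgpos]; linarith
    linarith [hm2.le]
  have hθs2 : θ ^ 2 ≤ θs ^ 2 := pow_le_pow_left₀ hθ.le hθs_ge 2
  rw [hgoal]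
  nlinarith [hT0, hdiv, hclose, hθs2, hη₀pos]

/-! ## The contrapositive: a linear two-arms rate `o(1/K)` gives `θ(p_c) = 0`, the conjunct, the crux, the stub -/

/-- **`θ(p_c) = 0` from a linear-scale two-arms RATE.**  If — in the hypothetical percolating world `θ(p_c) > 0` — for
every `ε > 0` some ratio `K ≥ 2` has `P_{p_c}(two-arms(n, K·n)) ≤ ε/K` for all large `n` (linear-scale box two-arms is
`o(1/K)`), then `θ(p_c(ℤ³)) = 0`.  Proof: otherwise `twoArms_criticalProbI_ge` gives `c·θ(p_c)²/K ≤ P(two-arms(n, Kn))`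
at `n = (2s+1)m` for all large `s`, `m`; take `ε := c·θ(p_c)²/2`. -/
theorem theta_criticalProbI_eq_zero_of_linearTwoArms_littleO
    (hX : 0 < theta (zdGraph 3) 0 (criticalProbI 3) →
      ∀ ε : ℝ, 0 < ε → ∃ K : ℕ, 2 ≤ K ∧ ∃ N : ℕ, ∀ n : ℕ, N ≤ n →
        (bondPercolation (zdGraph 3) (criticalProbI 3)).real
          {ω | ∃ x ∈ box 3 n, ∃ x' ∈ box 3 n,
            ∃ z ∈ innerBoundary (zdGraph 3) (box 3 (K * n)), ∃ z' ∈ innerBoundary (zdGraph 3) (box 3 (K * n)),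
              ω ∈ openConnIn ↑(box 3 (K * n)) x z ∧ ω ∈ openConnIn ↑(box 3 (K * n)) x' z' ∧
                ω ∉ openConnIn ↑(box 3 (K * n)) x x'} ≤ ε / K) :
    theta (zdGraph 3) 0 (criticalProbI 3) = 0 := by
  by_contra hne
  set θ : ℝ := theta (zdGraph 3) 0 (criticalProbI 3) with hθdef
  have hθ : 0 < θ := lt_of_le_of_ne measureReal_nonneg (Ne.symm hne)
  obtain ⟨c, hc, hall⟩ := twoArms_criticalProbI_ge
  have hε : 0 < c * θ ^ 2 / 2 := by positivity
  obtain ⟨K, hK, N, hN⟩ := hX hθ (c * θ ^ 2 / 2) hε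
  obtain ⟨s₀, hs₀⟩ := hall K hK
  obtain ⟨m₀, hm₀⟩ := hs₀ s₀ le_rfl
  set m : ℕ := max m₀ (max N 1) with hm
  have hlow := hm₀ m (le_max_left _ _)
  have hNn : N ≤ (2 * s₀ + 1) * m :=
    le_trans (le_trans (le_max_left _ _) (le_max_right _ _)) (Nat.le_mul_of_pos_left m (Nat.succ_pos _))
  have hup := hN ((2 * s₀ + 1) * m) hNn
  have hK0 : (0 : ℝ) < K := by exact_mod_cast (lt_of_lt_of_le (by norm_num) hK : 0 < K)
  have hlt : c * θ ^ 2 / 2 / K < c * θ ^ 2 / K := by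
    rw [div_lt_div_iff_of_pos_right hK0]
    linarith [mul_pos hc (pow_pos hθ 2)]
  linarith

/-- **The sub-problem's conjunct from a linear two-arms rate** (`Literature.Probability.Percolation.PercolationContinuityZ3`
is `θ_{ℤ³}(p_c) = 0` by `percolationContinuityZ3_iff`). -/
theorem percolationContinuityZ3_of_linearTwoArms_littleO
    (hX : 0 < theta (zdGraph 3) 0 (criticalProbI 3) →
      ∀ ε : ℝ, 0 < ε → ∃ K : ℕ, 2 ≤ K ∧ ∃ N : ℕ, ∀ n : ℕ, N ≤ n →
        (bondPercolation (zdGraph 3) (criticalProbI 3)).real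
          {ω | ∃ x ∈ box 3 n, ∃ x' ∈ box 3 n,
            ∃ z ∈ innerBoundary (zdGraph 3) (box 3 (K * n)), ∃ z' ∈ innerBoundary (zdGraph 3) (box 3 (K * n)),
              ω ∈ openConnIn ↑(box 3 (K * n)) x z ∧ ω ∈ openConnIn ↑(box 3 (K * n)) x' z' ∧
                ω ∉ openConnIn ↑(box 3 (K * n)) x x'} ≤ ε / K) :
    Literature.Probability.Percolation.PercolationContinuityZ3 :=
  percolationContinuityZ3_iff.2 (theta_criticalProbI_eq_zero_of_linearTwoArms_littleO hX)

/-- **No linear-scale finite-box LRO at `p_c` from a linear two-arms rate** (`LRO_lin(p_c) ⇒ ρ ≤ θ(p_c)`,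
`le_theta_of_linearLRO`, and `θ(p_c) = 0`). -/
theorem not_linearLRO_criticalProbI_of_linearTwoArms_littleO
    (hX : 0 < theta (zdGraph 3) 0 (criticalProbI 3) →
      ∀ ε : ℝ, 0 < ε → ∃ K : ℕ, 2 ≤ K ∧ ∃ N : ℕ, ∀ n : ℕ, N ≤ n →
        (bondPercolation (zdGraph 3) (criticalProbI 3)).real
          {ω | ∃ x ∈ box 3 n, ∃ x' ∈ box 3 n,
            ∃ z ∈ innerBoundary (zdGraph 3) (box 3 (K * n)), ∃ z' ∈ innerBoundary (zdGraph 3) (box 3 (K * n)),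
              ω ∈ openConnIn ↑(box 3 (K * n)) x z ∧ ω ∈ openConnIn ↑(box 3 (K * n)) x' z' ∧
                ω ∉ openConnIn ↑(box 3 (K * n)) x x'} ≤ ε / K) :
    ¬ (∃ ρ : ℝ, 0 < ρ ∧ ∃ K : ℕ, ∀ n : ℕ, 1 ≤ n → ∀ x ∈ box 3 n, ∀ y ∈ box 3 n,
        ρ ≤ (bondPercolation (zdGraph 3) (criticalProbI 3)).real (openConnIn ↑(box 3 (K * n)) x y)) := by
  rintro ⟨ρ, hρ, K, hK⟩
  have h := le_theta_of_linearLRO (criticalProbI 3) hK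
  rw [theta_criticalProbI_eq_zero_of_linearTwoArms_littleO hX] at h
  exact absurd h (not_le.2 hρ)

/-- **The crux BY NAME from a linear two-arms rate**: `RenormaliseFromLinearLRO` follows from `¬LRO_lin(p_c)`
(`renormaliseFromLinearLRO_of_not_linearLRO_criticalProbI`, p152652). -/
theorem renormaliseFromLinearLRO_of_linearTwoArms_littleO
    (hX : 0 < theta (zdGraph 3) 0 (criticalProbI 3) →
      ∀ ε : ℝ, 0 < ε → ∃ K : ℕ, 2 ≤ K ∧ ∃ N : ℕ, ∀ n : ℕ, N ≤ n →
        (bondPercolation (zdGraph 3) (criticalProbI 3)).real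
          {ω | ∃ x ∈ box 3 n, ∃ x' ∈ box 3 n,
            ∃ z ∈ innerBoundary (zdGraph 3) (box 3 (K * n)), ∃ z' ∈ innerBoundary (zdGraph 3) (box 3 (K * n)),
              ω ∈ openConnIn ↑(box 3 (K * n)) x z ∧ ω ∈ openConnIn ↑(box 3 (K * n)) x' z' ∧
                ω ∉ openConnIn ↑(box 3 (K * n)) x x'} ≤ ε / K) :
    Summit.CriticalPhenomena.PercolationContinuityZ3.Theses.PercFiniteBoxLRO.RenormaliseFromLinearLRO :=
  renormaliseFromLinearLRO_of_not_linearLRO_criticalProbI (not_linearLRO_criticalProbI_of_linearTwoArms_littleO hX)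

/-- **The line's open stub `stub_critSpine` from a linear two-arms rate** (vacuously: its hypothesis `LRO_lin(p_c)` with
`K ≥ 2` is then impossible).  So the registered open stub of line `registered` is implied by the rate statement. -/
theorem critSpine_of_linearTwoArms_littleO
    (hX : 0 < theta (zdGraph 3) 0 (criticalProbI 3) →
      ∀ ε : ℝ, 0 < ε → ∃ K : ℕ, 2 ≤ K ∧ ∃ N : ℕ, ∀ n : ℕ, N ≤ n →
        (bondPercolation (zdGraph 3) (criticalProbI 3)).real
          {ω | ∃ x ∈ box 3 n, ∃ x' ∈ box 3 n,
            ∃ z ∈ innerBoundary (zdGraph 3) (box 3 (K * n)), ∃ z' ∈ innerBoundary (zdGraph 3) (box 3 (K * n)),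
              ω ∈ openConnIn ↑(box 3 (K * n)) x z ∧ ω ∈ openConnIn ↑(box 3 (K * n)) x' z' ∧
                ω ∉ openConnIn ↑(box 3 (K * n)) x x'} ≤ ε / K) :
    ∀ (ρ : ℝ) (K : ℕ), 0 < ρ → 2 ≤ K →
      (∀ n : ℕ, 1 ≤ n → ∀ x ∈ box 3 n, ∀ y ∈ box 3 n,
        ρ ≤ (bondPercolation (zdGraph 3) (criticalProbI 3)).real (openConnIn ↑(box 3 (K * n)) x y)) →
      ∀ δ : ℝ, 0 < δ →
        ∃ K' s m L : ℕ, 2 ≤ K' ∧ K' ≤ L ∧ 1 ≤ m ∧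
          1 - δ < (bondPercolation (zdGraph 3) (criticalProbI 3)).real (spineBox K' s m L) := by
  intro ρ K hρ _hK hLRO
  exact absurd ⟨ρ, hρ, K, hLRO⟩ (not_linearLRO_criticalProbI_of_linearTwoArms_littleO hX)

/-! ## The rate from an exponent -/

/-- **A linear-scale box two-arms exponent `> 1` gives the rate.**  If for some `γ > 1` and `C` every ratio `K ≥ 2` has
`P_{p_c}(two-arms(n, K·n)) ≤ C·K^{-γ}` for all large `n`, then linear two-arms is `o(1/K)` in the sense of
`theta_criticalProbI_eq_zero_of_linearTwoArms_littleO` (indeed unconditionally, not only when `θ(p_c) > 0`):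
`C·K^{-γ} = (C·K^{1-γ})/K` and `K^{1-γ} → 0`. -/
theorem linearTwoArms_littleO_of_exponent
    (hγ : ∃ γ : ℝ, 1 < γ ∧ ∃ C : ℝ, ∀ K : ℕ, 2 ≤ K → ∃ N : ℕ, ∀ n : ℕ, N ≤ n →
      (bondPercolation (zdGraph 3) (criticalProbI 3)).real
        {ω | ∃ x ∈ box 3 n, ∃ x' ∈ box 3 n,
          ∃ z ∈ innerBoundary (zdGraph 3) (box 3 (K * n)), ∃ z' ∈ innerBoundary (zdGraph 3) (box 3 (K * n)),
            ω ∈ openConnIn ↑(box 3 (K * n)) x z ∧ ω ∈ openConnIn ↑(box 3 (K * n)) x' z' ∧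
              ω ∉ openConnIn ↑(box 3 (K * n)) x x'} ≤ C * (K : ℝ) ^ (-γ)) :
    ∀ ε : ℝ, 0 < ε → ∃ K : ℕ, 2 ≤ K ∧ ∃ N : ℕ, ∀ n : ℕ, N ≤ n →
      (bondPercolation (zdGraph 3) (criticalProbI 3)).real
        {ω | ∃ x ∈ box 3 n, ∃ x' ∈ box 3 n,
          ∃ z ∈ innerBoundary (zdGraph 3) (box 3 (K * n)), ∃ z' ∈ innerBoundary (zdGraph 3) (box 3 (K * n)),
            ω ∈ openConnIn ↑(box 3 (K * n)) x z ∧ ω ∈ openConnIn ↑(box 3 (K * n)) x' z' ∧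
              ω ∉ openConnIn ↑(box 3 (K * n)) x x'} ≤ ε / K := by
  obtain ⟨γ, hγ1, C, hC⟩ := hγ
  intro ε hε
  -- K large with C · K^{1-γ} ≤ ε
  have hlim : Tendsto (fun K : ℕ => C * (K : ℝ) ^ (1 - γ)) atTop (𝓝 0) := by
    have h1 : Tendsto (fun K : ℕ => (K : ℝ) ^ (-(γ - 1))) atTop (𝓝 0) :=
      (tendsto_rpow_neg_atTop (by linarith)).comp (tendsto_natCast_atTop_atTop (R := ℝ))
    have h2 : (fun K : ℕ => C * (K : ℝ) ^ (1 - γ)) = fun K : ℕ => C * (K : ℝ) ^ (-(γ - 1)) := by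
      funext K; congr 1; ring_nf
    rw [h2]
    simpa using h1.const_mul C
  obtain ⟨K, hK⟩ := ((hlim.eventually (gt_mem_nhds hε)).and (eventually_ge_atTop 2)).exists
  obtain ⟨hKε, hK2⟩ := hK
  obtain ⟨N, hN⟩ := hC K hK2
  refine ⟨K, hK2, N, fun n hn => (hN n hn).trans ?_⟩
  have hK0 : (0 : ℝ) < K := by exact_mod_cast (lt_of_lt_of_le (by norm_num) hK2 : 0 < K)
  have hsplit : C * (K : ℝ) ^ (-γ) = C * (K : ℝ) ^ (1 - γ) / K := by
    rw [mul_div_assoc]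
    congr 1
    rw [eq_div_iff hK0.ne', ← Real.rpow_add_one hK0.ne']
    ring_nf
  rw [hsplit]
  exact div_le_div_of_nonneg_right hKε.le hK0.le

/-! ## Registered sub-goals of the item (closed here) -/

/-- **Registered sub-goal `stub_twoArmsAllRatios` of crux stmt-CriticalPhenomena-0857 (line `registered`, lead cycle 3)**:
an absolute `c > 0` with `P_{p_c}(box two-arms at radii ((2s+1)m, K(2s+1)m)) ≥ c·θ(p_c)²/K` for every `K ≥ 2` and all
large `s`, `m`.  Unconditional (`twoArms_criticalProbI_ge`). -/
theorem stub_twoArmsAllRatios : ∃ c : ℝ, 0 < c ∧ ∀ K : ℕ, 2 ≤ K → ∃ s₀ : ℕ, ∀ s : ℕ, s₀ ≤ s → ∃ m₀ : ℕ, ∀ m : ℕ, m₀ ≤ m → c * theta (zdGraph 3) 0 (criticalProbI 3) ^ 2 / K ≤ (bondPercolation (zdGraph 3) (criticalProbI 3)).real {ω | ∃ x ∈ box 3 ((2 * s + 1) * m), ∃ x' ∈ box 3 ((2 * s + 1) * m), ∃ z ∈ innerBoundary (zdGraph 3) (box 3 (K * ((2 * s + 1) * m))), ∃ z' ∈ innerBoundary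 (zdGraph 3) (box 3 (K * ((2 * s + 1) * m))), ω ∈ openConnIn ↑(box 3 (K * ((2 * s + 1) * m))) x z ∧ ω ∈ openConnIn ↑(box 3 (K * ((2 * s + 1) * m))) x' z' ∧ ω ∉ openConnIn ↑(box 3 (K * ((2 * s + 1) * m))) x x'} :=
  twoArms_criticalProbI_ge

/-- **Registered sub-goal `stub_thetaZeroOfLinearTwoArmsRate` of crux stmt-CriticalPhenomena-0857 (line `registered`, lead
cycle 3)**: a linear-scale box two-arms rate `o(1/K)` at `p_c` (needed only if `θ(p_c) > 0`) gives `θ(p_c(ℤ³)) = 0`.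
Unconditional (`theta_criticalProbI_eq_zero_of_linearTwoArms_littleO`). -/
theorem stub_thetaZeroOfLinearTwoArmsRate : (0 < theta (zdGraph 3) 0 (criticalProbI 3) → ∀ ε : ℝ, 0 < ε → ∃ K : ℕ, 2 ≤ K ∧ ∃ N : ℕ, ∀ n : ℕ, N ≤ n → (bondPercolation (zdGraph 3) (criticalProbI 3)).real {ω | ∃ x ∈ box 3 n, ∃ x' ∈ box 3 n, ∃ z ∈ innerBoundary (zdGraph 3) (box 3 (K * n)), ∃ z' ∈ innerBoundary (zdGraph 3) (box 3 (K * n)), ω ∈ openConnIn ↑(box 3 (K * n)) x z ∧ ω ∈ openConnIn ↑(box 3 (K * n)) x' z' ∧ ω ∉ openConnIn ↑(box 3 (K * n)) x x'} ≤ ε / K) → theta (zdGraph 3) 0 (criticalProbI 3) = 0 :=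
  theta_criticalProbI_eq_zero_of_linearTwoArms_littleO

/-! ## Appendix (lead cycle 3, second landing): the guarded rate is conjunct-equivalent; the unguarded rate is the input -/

/-- **The GUARDED rate hypothesis is equivalent to the conjunct** (`←` is vacuous).  So the informative sufficient
condition of this file is the UNGUARDED rate — `∀ ε > 0, ∃ K ≥ 2, ∃ N, ∀ n ≥ N, P_{p_c}(two-arms(n, K·n)) ≤ ε/K`, a
statement about the real critical point of `ℤ³` (believed `≍ K^{-1.14}` from the backbone co-dimension; dimension-sensitive:
it fails for `d > 6`, where critical boxes carry many spanning clusters) — and `stub_thetaZeroOfLinearTwoArmsRate` is to be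
read as "unguarded rate ⇒ `θ(p_c) = 0`" (`theta_criticalProbI_eq_zero_of_linearTwoArms_rate` below). -/
theorem linearTwoArmsRateGuarded_iff :
    (0 < theta (zdGraph 3) 0 (criticalProbI 3) →
      ∀ ε : ℝ, 0 < ε → ∃ K : ℕ, 2 ≤ K ∧ ∃ N : ℕ, ∀ n : ℕ, N ≤ n →
        (bondPercolation (zdGraph 3) (criticalProbI 3)).real
          {ω | ∃ x ∈ box 3 n, ∃ x' ∈ box 3 n,
            ∃ z ∈ innerBoundary (zdGraph 3) (box 3 (K * n)), ∃ z' ∈ innerBoundary (zdGraph 3) (box 3 (K * n)),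
              ω ∈ openConnIn ↑(box 3 (K * n)) x z ∧ ω ∈ openConnIn ↑(box 3 (K * n)) x' z' ∧
                ω ∉ openConnIn ↑(box 3 (K * n)) x x'} ≤ ε / K) ↔
    theta (zdGraph 3) 0 (criticalProbI 3) = 0 :=
  ⟨theta_criticalProbI_eq_zero_of_linearTwoArms_littleO, fun h0 hpos => absurd h0 (ne_of_gt hpos)⟩

/-- **`θ(p_c) = 0` from the UNGUARDED linear two-arms rate** — the contentful reading of Stub T2. -/
theorem theta_criticalProbI_eq_zero_of_linearTwoArms_rate
    (hX : ∀ ε : ℝ, 0 < ε → ∃ K : ℕ, 2 ≤ K ∧ ∃ N : ℕ, ∀ n : ℕ, N ≤ n →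
      (bondPercolation (zdGraph 3) (criticalProbI 3)).real
        {ω | ∃ x ∈ box 3 n, ∃ x' ∈ box 3 n,
          ∃ z ∈ innerBoundary (zdGraph 3) (box 3 (K * n)), ∃ z' ∈ innerBoundary (zdGraph 3) (box 3 (K * n)),
            ω ∈ openConnIn ↑(box 3 (K * n)) x z ∧ ω ∈ openConnIn ↑(box 3 (K * n)) x' z' ∧
              ω ∉ openConnIn ↑(box 3 (K * n)) x x'} ≤ ε / K) :
    theta (zdGraph 3) 0 (criticalProbI 3) = 0 :=
  theta_criticalProbI_eq_zero_of_linearTwoArms_littleO fun _ => hX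

/-- **Registered sub-goal `stub_rateGuardedIffConjunct` of crux stmt-CriticalPhenomena-0857 (line `registered`, lead cycle 3)**:
the guarded rate hypothesis of `stub_thetaZeroOfLinearTwoArmsRate` is EQUIVALENT to `θ(p_c) = 0` (so only its unguarded
form is an informative input).  Unconditional (`linearTwoArmsRateGuarded_iff`). -/
theorem stub_rateGuardedIffConjunct : (0 < theta (zdGraph 3) 0 (criticalProbI 3) → ∀ ε : ℝ, 0 < ε → ∃ K : ℕ, 2 ≤ K ∧ ∃ N : ℕ, ∀ n : ℕ, N ≤ n → (bondPercolation (zdGraph 3) (criticalProbI 3)).real {ω | ∃ x ∈ box 3 n, ∃ x' ∈ box 3 n, ∃ z ∈ innerBoundary (zdGraph 3) (box 3 (K * n)), ∃ z' ∈ innerBoundary (zdGraph 3) (box 3 (K * n)), ω ∈ openConnIn ↑(box 3 (K * n)) x z ∧ ω ∈ openConnIn ↑(box 3 (K * n)) x' z' ∧ ω ∉ openConnIn ↑(box 3 (K * n)) x x'} ≤ ε / K) ↔ theta (zdGraph 3) 0 (criticalProbI 3) = 0 :=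
  linearTwoArmsRateGuarded_iff

end Summit.CriticalPhenomena.PercolationContinuityZ3.Theorems.RenormaliseFromLinearLRO

end
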